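import Summits.FinalStateConjecture.FinalStateConjecture.Theorems.EIHFluxBalanceInertialRecessionStubRechart3Window
import Summits.FinalStateConjecture.FinalStateConjecture.Theorems.EIHFluxBalanceInertialRecessionAnsatzDecay
import Summits.FinalStateConjecture.FinalStateConjecture.Theorems.SwallowTheDatumKerrShieldedSettlesStubKerrLeafSojournAux1

/-!
# Route EIHFluxBalance — `InertialRecession`, re-charting: the other holes' summands near a hole

Helper file for the crux `stmt-FinalStateConjecture-10166`
(`Summit.FinalStateConjecture.FinalStateConjecture.Theses.EIHFluxBalance.InertialRecession`),
line `sublinear-is-free-clean-window-charges`, stub `stub_rechart` (the transfer P2), part G1.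

Near hole `i` (lab points `x` on the slab `x⁰ = t` within distance `K` of the painted centre `ξᵢ(t)`),
the summand of every OTHER hole `j` is eventually `C²`-small and has positive painted radius:
`eventually_otherHole_small` (general frames and spins; the decay estimate
`exists_norm_iteratedFDeriv_ansatzSummand_le'` of `…AnsatzDecay` is fed with the NORMALISED frame of
hole `j`, whose inverse has bounded derivatives by `…InverseFrame`/`…Window`, and with the separation
`‖ξᵢ − ξⱼ‖ → ∞`). Geometric inputs: the rest radius of a boosted point is at least the lab distance
to the centre minus `|a|` (`sub_abs_le_radius_poincareInv`, Lorentz maps stretch spatial vectors; `‖x̲‖ − |a| ≤ r` is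
`KerrLeafSojourn.spatialNorm_sub_le_radius`).
[folklore]
-/

noncomputable section

set_option linter.dupNamespace false

open Set Filter Function Metric Topology TopologicalSpace
open scoped ContDiff Manifold ENNReal BigOperators
open Literature.Geometry.Lorentzian

namespace Summit.FinalStateConjecture.FinalStateConjecture.Theorems.SublinearIsFree.Rechart

/-! ### Geometry of the painted radius -/

/-- **The rest radius of a boosted point is at least the lab distance to the centre minus `|a|`**:
for `x⁰ = t`, `‖x̲ − ζ‖ − |a| ≤ r_a(Λ⁻¹(x − (t, ζ)))` (Lorentz maps stretch spatial vectors).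
[folklore] -/
theorem sub_abs_le_radius_poincareInv (Λ : lorentzGroup) (a : ℝ) {x : E4} {t : ℝ} (hx : x 0 = t) (ζ : E3) :
    ‖E4.spatial x - ζ‖ - |a| ≤ Kerr.radius a (poincareInv Λ (E4.ofTimeSpace t ζ) x) := by
  obtain ⟨h0, hn⟩ := sub_ofTimeSpace_apply_zero hx ζ
  have h1 := norm_le_spatialNorm_lorentz_apply Λ⁻¹ h0
  rw [coe_lorentz_inv, hn] at h1
  have h2 := Theorems.SwallowTheDatum.KerrShieldedSettles.KerrLeafSojourn.spatialNorm_sub_le_radius a (poincareInv Λ (E4.ofTimeSpace t ζ) x)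
  rw [poincareInv] at h2 ⊢
  linarith

/-- The spatial derivatives of the centre are bounded by those of the centre world-line:
`‖ξ^{(k)}(t)‖ ≤ ‖c^{(k)}(t)‖`. [folklore] -/
theorem norm_iteratedDeriv_le_centrePath {ξ : ℝ → E3} (hξ : ContDiff ℝ ∞ ξ) (k : ℕ) (t : ℝ) :
    ‖iteratedDeriv k ξ t‖ ≤ ‖iteratedDeriv k (centrePath ξ) t‖ := by
  have hc : ContDiff ℝ ∞ (centrePath ξ) := contDiff_centrePath hξ
  have hfun : ξ = fun s ↦ E4.spatial (centrePath ξ s) := by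
    funext s; rw [centrePath, E4.spatial_ofTimeSpace]
  have h := iteratedDeriv_clm_comp (E4.spatial : E4 →L[ℝ] E3) hc k t
  conv_lhs => rw [hfun, h]
  exact (E4.spatial.le_opNorm _).trans
    ((mul_le_mul_of_nonneg_right norm_spatialCLM_le (norm_nonneg _)).trans (by rw [one_mul]))

/-! ### The other holes near hole `i` -/

/-- **The summand of another hole is eventually `C²`-small with positive painted radius near hole
`i`.** For the normalised frame `Λ̃ⱼ` of hole `j` (smooth, decaying derivatives, bounded Lorentz
factor, future-pointing), centre `ξⱼ` with decaying mismatch, and separation `‖ξᵢ − ξⱼ‖ → ∞`: for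
every `K` and `η₂ > 0`, eventually in the lab time `t`, at every point `x` of the slab `x⁰ = t` with
`‖x̲ − ξᵢ(t)‖ ≤ K` the painted radius of hole `j` is positive and the derivatives of orders `≤ 2` of
its summand are `≤ η₂`. [folklore] -/
theorem eventually_otherHole_small {N : ℕ} (i j : Fin N) (M a : Fin N → ℝ) (ξ : Fin N → ℝ → E3)
    (Λt : Fin N → ℝ → lorentzGroup)
    (hΛt : ContDiff ℝ ∞ (fun t ↦ ((Λt j t : E4 ≃L[ℝ] E4) : E4 →L[ℝ] E4)))
    (hdec : ∀ m, 1 ≤ m → m ≤ 3 → Tendsto (fun t ↦ iteratedDeriv m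
      (fun s ↦ ((Λt j s : E4 ≃L[ℝ] E4) : E4 →L[ℝ] E4)) t) atTop (𝓝 0))
    {γ : ℝ} (hγ1 : 1 ≤ γ) (hγ : ∀ t, |((Λt j t : E4 ≃L[ℝ] E4) (E4.basisVector 0)) 0| ≤ γ)
    (hpos : ∀ t, 0 < ((Λt j t : E4 ≃L[ℝ] E4) (E4.basisVector 0)) 0) (hξ : ContDiff ℝ ∞ (ξ j))
    (hmis : ∀ m : ℕ, m ≤ 2 → Tendsto (fun t ↦ iteratedDeriv m (fun s ↦ deriv (ξ j) s -
      ((((Λt j s : E4 ≃L[ℝ] E4) (E4.basisVector 0)) 0)⁻¹ •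
        E4.spatial ((Λt j s : E4 ≃L[ℝ] E4) (E4.basisVector 0)))) t) atTop (𝓝 0))
    (hsep : Tendsto (fun t ↦ ‖ξ i t - ξ j t‖) atTop atTop) (K : ℝ) {η₂ : ℝ} (hη₂ : 0 < η₂) :
    ∀ᶠ t in atTop, ∀ x : E4, x 0 = t → ‖E4.spatial x - ξ i t‖ ≤ K →
      0 < Kerr.radius (a j) (poincareInv (Λt j t) (E4.ofTimeSpace t (ξ j t)) x) ∧
      ∀ l ≤ 2, ‖iteratedFDeriv ℝ l (fun z : E4 ↦ boostedKerrBilin (Λt j (z 0))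
        (E4.ofTimeSpace (z 0) (ξ j (z 0))) (M j) (a j) z - Minkowski.bilin) x‖ ≤ η₂ := by
  -- uniform bounds on the frame and centre data of hole `j`
  set Γ : ℝ := 4 * γ + 2 with hΓ
  have hΓ1 : 1 ≤ Γ := by rw [hΓ]; linarith
  obtain ⟨C0, hC00, hC0⟩ := exists_norm_iteratedFDeriv_ansatzSummand_le' 0 hΓ1
  obtain ⟨C1, hC10, hC1⟩ := exists_norm_iteratedFDeriv_ansatzSummand_le' 1 hΓ1
  obtain ⟨C2, hC20, hC2⟩ := exists_norm_iteratedFDeriv_ansatzSummand_le' 2 hΓ1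
  set C : ℝ := max C0 (max C1 C2) with hC
  have hC0' : 0 ≤ C := hC00.trans (le_max_left _ _)
  set L : ℝ := max 1 (2 * |a j|) + |a j| + 1 + |M j| * C / η₂ with hL
  have hL1 : max 1 (2 * |a j|) ≤ L := by
    rw [hL]; have := abs_nonneg (a j); have : 0 ≤ |M j| * C / η₂ := by positivity
    linarith
  have hLpos : 0 < L := lt_of_lt_of_le one_pos ((le_max_left _ _).trans hL1)
  have hLa : |a j| + 1 ≤ L := by
    rw [hL]; have : 0 ≤ max 1 (2 * |a j|) := le_trans zero_le_one (le_max_left _ _)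
    have : 0 ≤ |M j| * C / η₂ := by positivity
    linarith
  have hLM : |M j| * C ≤ η₂ * L := by
    have h1 : |M j| * C / η₂ ≤ L := by
      rw [hL]; have : 0 ≤ max 1 (2 * |a j|) := le_trans zero_le_one (le_max_left _ _)
      linarith [abs_nonneg (a j)]
    have := mul_le_mul_of_nonneg_left h1 hη₂.le
    rwa [mul_div_cancel₀ _ hη₂.ne'] at this
  -- the `1`-window of hole `j` and the separation
  obtain ⟨S, -, -, -, -, -, -, -, -, hc', hc'', -, hF', hF''⟩ :=
    exists_window (Λt j) (ξ j) hΛt hdec hγ hpos hξ hmis one_pos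
  have hsep' := hsep.eventually (eventually_ge_atTop (L + K))
  filter_upwards [hsep', eventually_ge_atTop S] with t ht hSt x hx hK
  -- distance from the other centre
  have hdist : L ≤ ‖E4.spatial x - ξ j t‖ := by
    have h1 : ‖ξ i t - ξ j t‖ ≤ ‖E4.spatial x - ξ j t‖ + ‖E4.spatial x - ξ i t‖ := by
      have := norm_sub_le_norm_sub_add_norm_sub (ξ i t) (E4.spatial x) (ξ j t)
      rw [norm_sub_rev (ξ i t) (E4.spatial x)] at this
      linarith
    linarith
  refine ⟨?_, fun l hl ↦ ?_⟩
  · have h := sub_abs_le_radius_poincareInv (Λt j t) (a j) hx (ξ j t)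
    linarith
  -- the decay estimate
  have hd : max 1 (2 * |a j|) ≤ ‖E4.spatial x - ξ j t‖ := hL1.trans hdist
  have hFs : ContDiff ℝ ∞ (fun s ↦ (((Λt j s : E4 ≃L[ℝ] E4).symm : E4 ≃L[ℝ] E4) : E4 →L[ℝ] E4)) :=
    contDiff_lorentz_symm (Λt j) hΛt
  have hFb : ∀ k ≤ 2, ‖iteratedDeriv k (fun s ↦ (((Λt j s : E4 ≃L[ℝ] E4).symm : E4 ≃L[ℝ] E4) : E4 →L[ℝ] E4)) t‖
      ≤ Γ := by
    intro k hk
    interval_cases k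
    · rw [iteratedDeriv_zero]
      have := norm_lorentz_symm_le_four_mul (Λt j) hγ t
      rw [hΓ]; linarith
    · rw [iteratedDeriv_one]; exact (hF' t hSt).trans (by rw [hΓ]; linarith)
    · exact (hF'' t hSt).trans (by rw [hΓ]; linarith)
  have hξb : ∀ k, 1 ≤ k → k ≤ 2 → ‖iteratedDeriv k (ξ j) t‖ ≤ Γ := by
    intro k hk1 hk2
    refine (norm_iteratedDeriv_le_centrePath hξ k t).trans ?_
    interval_cases k
    · rw [iteratedDeriv_one]
      have h1 : ‖deriv (centrePath (ξ j)) t‖ ≤ ‖deriv (centrePath (ξ j)) t - normVel (Λt j t)‖ +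
          ‖normVel (Λt j t)‖ := norm_le_norm_sub_add _ _
      have h2 : ‖normVel (Λt j t)‖ ≤ 4 * γ :=
        (norm_normVel_le _).trans (norm_frame_le_four_mul (Λt j) hγ t)
      have h3 := hc' t hSt
      rw [hΓ]; linarith
    · exact (hc'' t hSt).trans (by rw [hΓ]; linarith)
  have key : ∀ m ≤ 2, ‖iteratedFDeriv ℝ m (fun z : E4 ↦ boostedKerrBilin (Λt j (z 0))
      (E4.ofTimeSpace (z 0) (ξ j (z 0))) (M j) (a j) z - Minkowski.bilin) x‖ ≤
        |M j| * C / ‖E4.spatial x - ξ j t‖ := by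
    intro m hm
    have hdiv : ∀ {Cm : ℝ}, Cm ≤ C → |M j| * Cm / ‖E4.spatial x - ξ j t‖ ≤ |M j| * C / ‖E4.spatial x - ξ j t‖ :=
      fun hCm ↦ div_le_div_of_nonneg_right (mul_le_mul_of_nonneg_left hCm (abs_nonneg _))
        (hLpos.le.trans hdist)
    interval_cases m
    · exact (hC0 (M j) (a j) (Λt j) (ξ j) t x (hFs.of_le (WithTop.coe_le_coe.mpr le_top))
        (hξ.of_le (WithTop.coe_le_coe.mpr le_top)) (fun k hk ↦ hFb k (by omega)) (fun k hk1 hk2 ↦ hξb k hk1 (by omega))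
        hx hd).trans (hdiv (le_max_left _ _))
    · exact (hC1 (M j) (a j) (Λt j) (ξ j) t x (hFs.of_le (WithTop.coe_le_coe.mpr le_top))
        (hξ.of_le (WithTop.coe_le_coe.mpr le_top)) (fun k hk ↦ hFb k (by omega)) (fun k hk1 hk2 ↦ hξb k hk1 (by omega))
        hx hd).trans (hdiv ((le_max_left _ _).trans (le_max_right _ _)))
    · exact (hC2 (M j) (a j) (Λt j) (ξ j) t x (hFs.of_le (WithTop.coe_le_coe.mpr le_top))
        (hξ.of_le (WithTop.coe_le_coe.mpr le_top)) (fun k hk ↦ hFb k (by omega)) (fun k hk1 hk2 ↦ hξb k hk1 (by omega))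
        hx hd).trans (hdiv ((le_max_right _ _).trans (le_max_right _ _)))
  refine (key l hl).trans ?_
  rw [div_le_iff₀ (hLpos.trans_le hdist)]
  exact hLM.trans (mul_le_mul_of_nonneg_left hdist hη₂.le)

/-- Registered one-line form (worker carrier `rechart_sub_abs_le_radius_poincareInv`). [folklore] -/
theorem rechart_sub_abs_le_radius_poincareInv : open Literature.Geometry.Lorentzian in ∀ (Λ : lorentzGroup) (a : ℝ) {x : E4} {t : ℝ}, x 0 = t → ∀ (ζ : E3), ‖E4.spatial x - ζ‖ - |a| ≤ Kerr.radius a (poincareInv Λ (E4.ofTimeSpace t ζ) x) :=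
  fun Λ a _ _ hx ζ ↦ sub_abs_le_radius_poincareInv Λ a hx ζ

end Summit.FinalStateConjecture.FinalStateConjecture.Theorems.SublinearIsFree.Rechart

end
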